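import Mathlib
import Summits.Ventures.PercRepro2.OneEdge
import Summits.Ventures.PercRepro2.KPrimeReduction
import Summits.Ventures.PercRepro2.KPrimeBase
import Summits.Ventures.PercRepro2.KPrimeSure
import Summits.Ventures.PercRepro2.KPrimeEdgeSteps
import Summits.Ventures.PercRepro2.KPrimeVEdge
import Summits.Ventures.PercRepro2.KPrimeVYDict
import Summits.Ventures.PercRepro2.KPrimeVYEdge
import Summits.Ventures.PercRepro2.KPrimeVBAlgebra

/-!
# Resolving an edge from the root of `v` into the mark `b` keeps `(K′)` — modulo `(K′)` for the
world `e` closed with the marks `y` and `b` (blind cell PercRepro2, mine-c g35;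
`conjectures/MINE-C.md` §44.1, the cleared form of §43.11's (F11))

The `v`-EXPLORATION of `(K′)` (`MINE-C.md` §42, `KPrimeVInduction.lean`) resolves the edges at the
weight-`1` root of `v`.  This file closes the edge class INTO THE MARK `b`: for an unresolved edge
`e = {x, b}` with `x` in the root of `v`,

  `kprimeHolds_of_update_zero_vb : (K′)(p[e ↦ 0]) → (K′)(p[e ↦ 0]; y := b) → (K′)(p)`

— the two hypotheses are the world-`0` instance with its own mark `y` and with the mark `y`
REPLACED BY `b`; `(K′)` for the world `e` open is NOT needed (there `b ∈ C(v)` is sure, the lean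
`E₀` is `0`, and the form is `P(N)·P(S)²·(E-slope) ≥ 0` by BHK06 1.4 alone).

Mechanism (exact; `MINE-C.md` §44.1, 1,970 random instances, two codes).  With `e` open, `b ↔ v`
is sure: `X = U`, `Xᵉ ≡ 1`, `X ∩ N = ∅`; the dictionary of `KPrimeVYDict.lean` with `y := b` gives
`P¹(S) = P⁰(S) − P⁰(b ∈ C₂, S)`, `P¹(U ∩ Ω) = P⁰(U ∩ Ω) − P⁰(U, b ∈ C₂, Ω) + P⁰((0,1)_b)`,
`P¹(N) = P⁰(N) − P⁰(X ∩ N)`, and `P¹(Y ∩ S) = P⁰(Y ∩ S) − P⁰(Y, b ∈ C₂, S)`.  The cleared form then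
satisfies EXACTLY, with `S⁰ = P⁰(S)`, `S¹ = P¹(S)`, `t = p e`,

  `S⁰·S¹·form(p) = (1 − t)·P(S)·S¹·G⁰ + t·(P(N) − P(X∩N))·P(S)·S⁰·Q¹ + t(1 − t)·PA·(G⁰_b + P(N)·S⁰·B̂)`

with `G⁰` / `G⁰_b` the world-`0` forms (marks `y` / `b`) at the PARENT's threshold (`≥ 0` by the
threshold lemma `thr_nonneg`), `Q¹` the world-`1` `E`-slope (`≥ 0`, `slope_ineq`),
`PA = P⁰(S)·P⁰(y, b ∈ C₂, S) − P⁰(b ∈ C₂, S)·P⁰(y ∈ C₂, S) ≥ 0` (van den Berg–Kahn for `a₂`) and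
`B̂ = P⁰(U ∩ Ω) − P⁰(U, b ∈ C₂, Ω) − P⁰(U ∩ X ∩ Ω) ≥ 0`.  Together with
`kprimeHolds_of_update_zero_va₁` / `_va₂` (`KPrimeVEdge.lean`) and `_vy` (`KPrimeVYEdge.lean`),
four of the five edge classes of the `v`-exploration are theorems; the open class is the edge into
a FREE vertex.
-/

namespace Summit.Ventures.PercRepro2

namespace KPrime

variable {V : Type*} {E : Type*} [Fintype E] [DecidableEq E] [Fintype V] [DecidableEq V]
  {R : Type*} [Field R] [LinearOrder R] [IsStrictOrderedRing R]

section StepVB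

variable {ends : E → Sym2 V} {a₁ a₂ b v y : V} {p : E → R} {e : E}

omit [Fintype E] [Fintype V] [IsStrictOrderedRing R] in
/-- `Y ∩ S` with `e = {x, b}` open is `Y ∩ S ∩ {a₂ ↮ b}` with `e` closed. -/
lemma YS_dict_vb {x : V} (hends : ends e = s(x, b)) (hx : x ∈ root p ends v) (he : p e ≠ 1)
    (ω : Config E) (hle : oneConfig p ≤ ω) :
    Function.update ω e true ∈ connEvent ends a₂ y ∩ S ends a₁ a₂ v ↔
      Function.update ω e false ∈
        connEvent ends a₂ y ∩ S ends a₁ a₂ v ∩ (connEvent ends a₂ b)ᶜ := by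
  set ω' := Function.update ω e false with hω'
  have hle' : oneConfig p ≤ ω' := oneConfig_le_update_false he hle
  have hvx : Conn ends ω' v x := conn_mono hle' hx
  have heq : Function.update ω e true = Function.update ω' e true := by
    simp [hω', Function.update_idem]
  rw [heq]
  simp only [Set.mem_inter_iff, Set.mem_compl_iff, mem_connEvent, mem_S,
    conn_update_true_iff_v hends hvx]
  constructor
  · rintro ⟨hy, h1, h2⟩
    have hv : ¬ Conn ends ω' a₂ v := fun h => h2 (Or.inl h)
    have hb : ¬ Conn ends ω' a₂ b := fun h => h2 (Or.inr (Or.inr ⟨h, conn_refl _ _ _⟩))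
    have ha : ¬ Conn ends ω' a₂ a₁ := fun h => h1 (Or.inl h)
    refine ⟨⟨?_, ha, hv⟩, hb⟩
    rcases hy with h | ⟨h3, _⟩ | ⟨h3, _⟩
    · exact h
    · exact absurd h3 hv
    · exact absurd h3 hb
  · rintro ⟨⟨hy, ha, hv⟩, hb⟩
    refine ⟨Or.inl hy, ?_, ?_⟩
    · rintro (h | ⟨h3, _⟩ | ⟨h3, _⟩)
      · exact ha h
      · exact hv h3
      · exact hb h3
    · rintro (h | ⟨h3, _⟩ | ⟨h3, _⟩)
      · exact hv h
      · exact hv h3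
      · exact hb h3

omit [Fintype V] [IsStrictOrderedRing R] in
/-- `P¹(Y ∩ S) = P⁰(Y ∩ S ∩ {a₂ ↮ b})`. -/
lemma prob_YS_vb {x : V} (hends : ends e = s(x, b)) (hx : x ∈ root p ends v) (he : p e ≠ 1) :
    prob (Function.update p e 1) (connEvent ends a₂ y ∩ S ends a₁ a₂ v) =
      prob (Function.update p e 0)
        (connEvent ends a₂ y ∩ S ends a₁ a₂ v ∩ (connEvent ends a₂ b)ᶜ) :=
  prob_update_one_eq_update_zero_of_iff he (YS_dict_vb hends hx he)

/-! ### With `e = {x, b}` pinned open, `b ↔ v` is sure: `X = U`, `Xᵉ ≡ 1`, `X ∩ N = ∅` -/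

omit [Fintype V] [DecidableEq V] [IsStrictOrderedRing R] in
/-- `P¹(U ∩ X ∩ Ω) = P¹(U ∩ Ω)`. -/
lemma prob_UXΩ_eq_UΩ_vb {x : V} (hends : ends e = s(x, b)) (hx : x ∈ root p ends v)
    (he : p e ≠ 1) :
    prob (Function.update p e 1) (connEvent ends a₁ v ∩ connEvent ends a₁ b ∩ Ω ends a₁ a₂) =
      prob (Function.update p e 1) (connEvent ends a₁ v ∩ Ω ends a₁ a₂) := by
  apply prob_congr_sure
  ext ω
  constructor
  · rintro ⟨⟨⟨hu, _⟩, hΩ⟩, hω⟩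
    exact ⟨⟨hu, hΩ⟩, hω⟩
  · rintro ⟨⟨hu, hΩ⟩, hω⟩
    exact ⟨⟨⟨hu, conn_trans hu
      (conn_symm (conn_y_v_of_mem_sureSet_update_one hends hx he hω))⟩, hΩ⟩, hω⟩

omit [Fintype V] [DecidableEq V] [IsStrictOrderedRing R] in
/-- `P¹(U ∩ Y ∩ X ∩ Ω) = P¹(U ∩ Y ∩ Ω)`. -/
lemma prob_UYXΩ_eq_UYΩ_vb {x : V} (hends : ends e = s(x, b)) (hx : x ∈ root p ends v)
    (he : p e ≠ 1) :
    prob (Function.update p e 1)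
        (connEvent ends a₁ v ∩ connEvent ends a₂ y ∩ connEvent ends a₁ b ∩ Ω ends a₁ a₂) =
      prob (Function.update p e 1) (connEvent ends a₁ v ∩ connEvent ends a₂ y ∩ Ω ends a₁ a₂) := by
  apply prob_congr_sure
  ext ω
  constructor
  · rintro ⟨⟨⟨⟨hu, hy⟩, _⟩, hΩ⟩, hω⟩
    exact ⟨⟨⟨hu, hy⟩, hΩ⟩, hω⟩
  · rintro ⟨⟨⟨hu, hy⟩, hΩ⟩, hω⟩
    exact ⟨⟨⟨⟨hu, hy⟩, conn_trans hu
      (conn_symm (conn_y_v_of_mem_sureSet_update_one hends hx he hω))⟩, hΩ⟩, hω⟩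

omit [Fintype V] [IsStrictOrderedRing R] in
/-- `P¹(X ∩ N) = 0`. -/
lemma prob_XN_eq_zero_vb {x : V} (hends : ends e = s(x, b)) (hx : x ∈ root p ends v)
    (he : p e ≠ 1) :
    prob (Function.update p e 1) (connEvent ends a₁ b ∩ N ends a₁ a₂ v) = 0 :=
  prob_update_one_eq_zero_of_yv hends hx he fun _ ⟨hb, hN⟩ hbv =>
    (mem_N.1 hN).2 (conn_trans hb hbv)

omit [Fintype V] [IsStrictOrderedRing R] in
/-- `P¹((0,1)ᵉ) = P¹((0,1))`. -/
lemma prob_cls01e_eq_cls01_vb {x : V} (hends : ends e = s(x, b)) (hx : x ∈ root p ends v)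
    (he : p e ≠ 1) :
    prob (Function.update p e 1) (cls01e ends a₁ a₂ b v y) =
      prob (Function.update p e 1) (cls01 ends a₁ a₂ v y) := by
  apply prob_congr_sure
  ext ω
  constructor
  · rintro ⟨⟨h1, _⟩, hω⟩
    exact ⟨h1, hω⟩
  · rintro ⟨h1, hω⟩
    exact ⟨⟨h1, Or.inr (conn_symm (conn_y_v_of_mem_sureSet_update_one hends hx he hω))⟩, hω⟩

/-! ### The world-`0` instance with the mark `b`: `(0,1)ᵉ_b = (0,1)_b` and `C_b = ∅` -/

omit [Fintype E] [DecidableEq E] [Fintype V] in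
/-- `(0,1)ᵉ` with the mark `y := b` is `(0,1)` with the mark `b`. -/
lemma cls01e_b_eq : cls01e ends a₁ a₂ b v b = cls01 ends a₁ a₂ v b := by
  ext ω
  constructor
  · rintro ⟨h1, _⟩; exact h1
  · intro h1; exact ⟨h1, Or.inl h1.1.2⟩

omit [Fintype E] [DecidableEq E] [Fintype V] [DecidableEq V] in
/-- `U ∩ {b ∈ C₂} ∩ X ∩ Ω = ∅`. -/
lemma UXbXΩ_eq_empty :
    connEvent ends a₁ v ∩ connEvent ends a₂ b ∩ connEvent ends a₁ b ∩ Ω ends a₁ a₂ =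
      (∅ : Set (Config E)) := by
  ext ω
  simp only [Set.mem_empty_iff_false, iff_false]
  rintro ⟨⟨⟨_, hb2⟩, hb1⟩, hΩ⟩
  exact (mem_Ω.1 hΩ) (conn_trans hb1 (conn_symm hb2))

/-- **van den Berg–Kahn for `a₂` in `S`**: `P(Y ∩ S) · P(b ∈ C₂, S) ≤ P(Y, b ∈ C₂, S) · P(S)`. -/
lemma pa_ineq_vb (hp : IsProbVec p) :
    prob p (connEvent ends a₂ y ∩ S ends a₁ a₂ v) * prob p (connEvent ends a₂ b ∩ S ends a₁ a₂ v) ≤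
      prob p (connEvent ends a₂ y ∩ S ends a₁ a₂ v ∩ connEvent ends a₂ b) *
        prob p (S ends a₁ a₂ v) := by
  have h := vdBK p hp ends a₂ {y} {b} {a₁, v} {a₁, v}
  have e1 : ∀ c : V, connAll ends a₂ {c} = connEvent ends a₂ c := by
    intro c; ext ω; simp [connAll]
  have e3 : connAll ends a₂ ({y} ∪ {b}) ∩ avoidAll ends a₂ {a₁, v} =
      connEvent ends a₂ y ∩ avoidAll ends a₂ {a₁, v} ∩ connEvent ends a₂ b := by
    ext ω; simp only [connAll, Set.mem_inter_iff, Set.mem_setOf_eq, Finset.mem_union,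
      Finset.mem_singleton, forall_eq_or_imp, forall_eq, mem_connEvent]; tauto
  simp only [Finset.inter_self, Finset.union_self, e1] at h
  rw [e3] at h
  simpa only [S] using h

/-! ### The theorem -/

/-- **Resolving an edge from the root of `v` into the mark `b`**: `(K′)` for the world `e` closed,
with the mark `y` and with the mark `b`, gives `(K′)`. -/
theorem kprimeHolds_of_update_zero_vb (hp : IsProbVec p) {x : V} (hends : ends e = s(x, b))
    (hx : x ∈ root p ends v) (he : p e ≠ 1)
    (h0 : KPrimeHolds ends a₁ a₂ b v y (Function.update p e 0))
    (h0b : KPrimeHolds ends a₁ a₂ b v b (Function.update p e 0)) :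
    KPrimeHolds ends a₁ a₂ b v y p := by
  have hp0 : IsProbVec (Function.update p e 0) := hp.update e le_rfl zero_le_one
  have hp1 : IsProbVec (Function.update p e 1) := hp.update e zero_le_one le_rfl
  -- world `1`: the sure-set identities
  have s1 := prob_UXΩ_eq_UΩ_vb (a₁ := a₁) (a₂ := a₂) hends hx he
  have s2 := prob_UYXΩ_eq_UYΩ_vb (a₁ := a₁) (a₂ := a₂) (y := y) hends hx he
  have s3 := prob_XN_eq_zero_vb (a₁ := a₁) (a₂ := a₂) hends hx he
  have s4 := prob_cls01e_eq_cls01_vb (a₁ := a₁) (a₂ := a₂) (y := y) hends hx he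
  -- world `1`: the dictionary (`KPrimeVYDict` with `y := b`)
  have hS1 := prob_S_vy (a₁ := a₁) (a₂ := a₂) (y := b) hends hx he
  have hN1 := prob_N_vy (a₁ := a₁) (a₂ := a₂) (y := b) hends hx he
  have hH1 := prob_UΩ_vy (a₁ := a₁) (a₂ := a₂) (y := b) hends hx he
  have hYS1 := prob_YS_vb (a₁ := a₁) (a₂ := a₂) (y := y) hends hx he
  -- world `0`: decompositions along `{a₂ ↔ b}` and `X`
  have eS := prob_inter_add_prob_inter_compl (Function.update p e 0) (S ends a₁ a₂ v)
    (connEvent ends a₂ b)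
  have eH := prob_inter_add_prob_inter_compl (Function.update p e 0)
    (connEvent ends a₁ v ∩ Ω ends a₁ a₂) (connEvent ends a₂ b)
  have eY := prob_inter_add_prob_inter_compl (Function.update p e 0)
    (connEvent ends a₂ y ∩ S ends a₁ a₂ v) (connEvent ends a₂ b)
  have eN := prob_inter_add_prob_inter_compl (Function.update p e 0) (N ends a₁ a₂ v)
    (connEvent ends a₁ b)
  have kS : S ends a₁ a₂ v ∩ connEvent ends a₂ b = connEvent ends a₂ b ∩ S ends a₁ a₂ v :=
    Set.inter_comm _ _
  have kH : connEvent ends a₁ v ∩ Ω ends a₁ a₂ ∩ connEvent ends a₂ b =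
      connEvent ends a₁ v ∩ connEvent ends a₂ b ∩ Ω ends a₁ a₂ := by
    ext ω; simp only [Set.mem_inter_iff]; tauto
  have kN : N ends a₁ a₂ v ∩ connEvent ends a₁ b = connEvent ends a₁ b ∩ N ends a₁ a₂ v :=
    Set.inter_comm _ _
  rw [kS] at eS
  rw [kH] at eH
  rw [kN] at eN
  -- the world-`1` inequalities, in world-`1` terms
  have hQ1 := slope_ineq (Function.update p e 1) ends a₁ a₂ v y hp1
  have hH1_le : prob (Function.update p e 1) (connEvent ends a₁ v ∩ Ω ends a₁ a₂) ≤
      prob (Function.update p e 1) (S ends a₁ a₂ v) := by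
    rw [U_inter_Ω_eq]; exact prob_mono hp1 Set.inter_subset_right
  have hD1_le : prob (Function.update p e 1)
      (connEvent ends a₁ v ∩ connEvent ends a₂ y ∩ Ω ends a₁ a₂) ≤
      prob (Function.update p e 1) (connEvent ends a₂ y ∩ S ends a₁ a₂ v) := by
    refine prob_mono hp1 fun ω hω => ?_
    obtain ⟨⟨hu, hy⟩, hΩ⟩ := hω
    refine ⟨hy, mem_S.2 ⟨fun h => (mem_Ω.1 hΩ) (conn_symm h),
      fun h => (mem_Ω.1 hΩ) (conn_trans hu (conn_symm h))⟩⟩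
  have hO11_le : prob (Function.update p e 1) (cls01 ends a₁ a₂ v y) ≤
      prob (Function.update p e 1) (S ends a₁ a₂ v) := prob_mono hp1 cls01_subset_S
  have hD1 := prob_nonneg hp1 (connEvent ends a₁ v ∩ connEvent ends a₂ y ∩ Ω ends a₁ a₂)
  have hO11 := prob_nonneg hp1 (cls01 ends a₁ a₂ v y)
  rw [hS1, hH1, hYS1] at hQ1
  rw [hS1, hH1] at hH1_le
  rw [hYS1] at hD1_le
  rw [hS1] at hO11_le
  -- the world-`0` inequalities
  have hβ := slope_ineq (Function.update p e 0) ends a₁ a₂ v y hp0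
  have hβb := slope_ineq (Function.update p e 0) ends a₁ a₂ v b hp0
  have hPA := pa_ineq_vb (ends := ends) (a₁ := a₁) (a₂ := a₂) (b := b) (v := v) (y := y) hp0
  have hBh : prob (Function.update p e 0)
        (connEvent ends a₁ v ∩ connEvent ends a₁ b ∩ Ω ends a₁ a₂) +
      prob (Function.update p e 0) (connEvent ends a₁ v ∩ connEvent ends a₂ b ∩ Ω ends a₁ a₂) ≤
      prob (Function.update p e 0) (connEvent ends a₁ v ∩ Ω ends a₁ a₂) := by
    rw [← prob_union_of_disjoint]
    · refine prob_mono hp0 fun ω hω => ?_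
      rcases hω with ⟨⟨hu, _⟩, hΩ⟩ | ⟨⟨hu, _⟩, hΩ⟩ <;> exact ⟨hu, hΩ⟩
    · exact Set.disjoint_left.2 fun ω ⟨⟨_, hb1⟩, hΩ⟩ ⟨⟨_, hb2⟩, _⟩ =>
        (mem_Ω.1 hΩ) (conn_trans hb1 (conn_symm hb2))
  have hn0d0 : prob (Function.update p e 0) (connEvent ends a₁ b ∩ N ends a₁ a₂ v) ≤
      prob (Function.update p e 0) (N ends a₁ a₂ v) := prob_mono hp0 Set.inter_subset_right
  have hYs_le : prob (Function.update p e 0) (connEvent ends a₂ y ∩ S ends a₁ a₂ v) ≤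
      prob (Function.update p e 0) (S ends a₁ a₂ v) := prob_mono hp0 Set.inter_subset_right
  have hYS1_le : prob (Function.update p e 0)
      (connEvent ends a₂ y ∩ S ends a₁ a₂ v ∩ (connEvent ends a₂ b)ᶜ) ≤
      prob (Function.update p e 0) (S ends a₁ a₂ v ∩ (connEvent ends a₂ b)ᶜ) :=
    prob_mono hp0 (Set.inter_subset_inter_left _ Set.inter_subset_right)
  -- the `b`-instance hypothesis
  unfold KPrimeHolds kprimeForm at h0 h0b ⊢
  rw [cls01e_b_eq, UXbXΩ_eq_empty, prob_empty] at h0b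
  -- expand the form
  rw [prob_eq_pin p (connEvent ends a₁ v ∩ connEvent ends a₁ b ∩ Ω ends a₁ a₂) e,
    prob_eq_pin p (connEvent ends a₁ b ∩ N ends a₁ a₂ v) e,
    prob_eq_pin p (N ends a₁ a₂ v) e,
    prob_eq_pin p (connEvent ends a₁ v ∩ Ω ends a₁ a₂) e,
    prob_eq_pin p (connEvent ends a₂ y ∩ S ends a₁ a₂ v) e,
    prob_eq_pin p (S ends a₁ a₂ v) e,
    prob_eq_pin p (cls01e ends a₁ a₂ b v y) e,
    prob_eq_pin p (cls01 ends a₁ a₂ v y) e,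
    prob_eq_pin p (connEvent ends a₁ v ∩ connEvent ends a₂ y ∩ connEvent ends a₁ b ∩ Ω ends a₁ a₂) e,
    prob_eq_pin p (connEvent ends a₁ v ∩ connEvent ends a₂ y ∩ Ω ends a₁ a₂) e]
  rw [s1, s2, s3, s4, hS1, hN1, hH1, hYS1]
  have eSc : prob (Function.update p e 0) (S ends a₁ a₂ v ∩ (connEvent ends a₂ b)ᶜ) =
      prob (Function.update p e 0) (S ends a₁ a₂ v) -
        prob (Function.update p e 0) (connEvent ends a₂ b ∩ S ends a₁ a₂ v) := by linarith
  have eHc : prob (Function.update p e 0)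
      (connEvent ends a₁ v ∩ Ω ends a₁ a₂ ∩ (connEvent ends a₂ b)ᶜ) =
      prob (Function.update p e 0) (connEvent ends a₁ v ∩ Ω ends a₁ a₂) -
        prob (Function.update p e 0) (connEvent ends a₁ v ∩ connEvent ends a₂ b ∩ Ω ends a₁ a₂) := by
    linarith
  have eYc : prob (Function.update p e 0)
      (connEvent ends a₂ y ∩ S ends a₁ a₂ v ∩ (connEvent ends a₂ b)ᶜ) =
      prob (Function.update p e 0) (connEvent ends a₂ y ∩ S ends a₁ a₂ v) -
        prob (Function.update p e 0)
          (connEvent ends a₂ y ∩ S ends a₁ a₂ v ∩ connEvent ends a₂ b) := by linarith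
  have eNc : prob (Function.update p e 0) (N ends a₁ a₂ v ∩ (connEvent ends a₁ b)ᶜ) =
      prob (Function.update p e 0) (N ends a₁ a₂ v) -
        prob (Function.update p e 0) (connEvent ends a₁ b ∩ N ends a₁ a₂ v) := by linarith
  rw [eSc, eHc, eYc, eNc]
  rw [eSc, eHc, eYc] at hQ1
  rw [eSc, eHc] at hH1_le
  rw [eYc] at hD1_le
  rw [eSc] at hO11_le
  rw [eSc, eYc] at hYS1_le
  have hS1 : 0 ≤ prob (Function.update p e 0) (S ends a₁ a₂ v) -
      prob (Function.update p e 0) (connEvent ends a₂ b ∩ S ends a₁ a₂ v) := by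
    have := prob_nonneg hp0 (S ends a₁ a₂ v ∩ (connEvent ends a₂ b)ᶜ)
    linarith
  have hYS1' : 0 ≤ prob (Function.update p e 0) (connEvent ends a₂ y ∩ S ends a₁ a₂ v) -
      prob (Function.update p e 0)
        (connEvent ends a₂ y ∩ S ends a₁ a₂ v ∩ connEvent ends a₂ b) := by
    have := prob_nonneg hp0 (connEvent ends a₂ y ∩ S ends a₁ a₂ v ∩ (connEvent ends a₂ b)ᶜ)
    linarith
  have hH1' : 0 ≤ prob (Function.update p e 0) (connEvent ends a₁ v ∩ Ω ends a₁ a₂) -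
      prob (Function.update p e 0) (connEvent ends a₁ v ∩ connEvent ends a₂ b ∩ Ω ends a₁ a₂) +
      prob (Function.update p e 0) (cls01 ends a₁ a₂ v b) := by
    have := prob_nonneg hp0 (connEvent ends a₁ v ∩ Ω ends a₁ a₂ ∩ (connEvent ends a₂ b)ᶜ)
    have := prob_nonneg hp0 (cls01 ends a₁ a₂ v b)
    linarith
  have key := vb_form_nonneg (hp.nonneg e) (hp.le_one e)
    (prob_nonneg hp0 (S ends a₁ a₂ v))
    (prob_nonneg hp0 (connEvent ends a₂ y ∩ S ends a₁ a₂ v))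
    (prob_nonneg hp0 (connEvent ends a₂ b ∩ S ends a₁ a₂ v))
    (prob_nonneg hp0 (cls01 ends a₁ a₂ v y))
    (prob_nonneg hp0 (cls01 ends a₁ a₂ v b)) hO11
    (prob_nonneg hp0 (connEvent ends a₂ y ∩ S ends a₁ a₂ v ∩ connEvent ends a₂ b)) hD1
    (prob_nonneg hp0 (N ends a₁ a₂ v))
    (prob_nonneg hp0 (connEvent ends a₁ b ∩ N ends a₁ a₂ v)) hn0d0
    hS1 hYs_le hYS1' hYS1_le hH1' hH1_le hD1_le hO11_le hBh hβ hβb hQ1 (by linarith [hPA]) h0 h0b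
  linarith [key]

end StepVB

end KPrime

end Summit.Ventures.PercRepro2
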